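import Literature.Analysis.FluidPDE.StokesTorusProofs

/-!
# Route ImpulseGrid (AnomalousDissipation) — crux `GridThesis`, line `Sketch`: the strain bound

Stub `stub_acdcStrainBound` (W9) of the checked skeleton of crux item stmt-AnomalousDissipation-1770
(`Summit.AnomalousDissipation.AnomalousDissipation.Theses.ImpulseGrid.GridThesis`).

**The strain constant of the cellular pattern.** For the two-mode sine Stokes pattern
`G = A [sin 2πm(x₁+x₂) (e₁−e₂) + sin 2πm(x₁−x₂) (e₁+e₂)]` (`Torus.stokesMode k a false` at the
frequencies `k₊ = (0,m,m)`, `k₋ = (0,m,−m)` with the transversal amplitudes `a₊ = e₁ − e₂`,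
`a₋ = e₁ + e₂`) the quadratic form of the velocity gradient is, with `p = cos 2πm(x₁+x₂)`,
`q = cos 2πm(x₁−x₂)`,
`⟪ξ, (ξ·∇)G⟫ = 2πmA (p + q) (ξ₁² − ξ₂²)`
(the antisymmetric cross terms cancel), whence the strain bound `|⟪ξ, (ξ·∇)G⟫| ≤ 4πmA |ξ|²` used
by the no-reversal barrier. Ingredients: `(ξ·∇)G = DG[ξ] = Σⱼ ξⱼ ∂ⱼG`
(`Torus.fderiv_apply_eq_sum_partialDeriv`), `∂ⱼ (Im e_k • a) = (2π kⱼ Re e_k) • a`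
(`Torus.partialDeriv_mFourier`: `∂ⱼ e_k = 2πi kⱼ e_k`), `|Re e_k| ≤ ‖e_k‖ = 1`.

References: Constantin–Foias 1988, Ch. 4 (4.13)–(4.14) (Stokes eigenfields on the torus);
Grafakos 2014, Prop. 3.2.6 (derivatives of characters).
-/

noncomputable section

-- `Summit.<Summit>.<Problem>` is the tree's mandated summit-side namespace (CONVENTIONS §2); for this
-- single-conjunct summit the two coincide, so the duplicate is deliberate.
set_option linter.dupNamespace false

open MeasureTheory Set Filter Topology
open scoped InnerProductSpace RealInnerProductSpace

namespace Summit.AnomalousDissipation.AnomalousDissipation.Theorems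

open Literature.Analysis.FluidPDE Literature.Analysis.FluidPDE.Torus
open Literature.Analysis.FunctionSpaces Literature.Analysis.FunctionSpaces.Torus

namespace AcdcStrain

/-! ### Partial derivatives of the two-mode sine pattern -/

/-- `∂ⱼ (Im e_k • a) = (2π kⱼ Re e_k) • a`: the partial derivatives of a sine Stokes mode
(Grafakos 2014, Prop. 3.2.6). [folklore] -/
theorem partialDeriv_stokesMode_sin (k : Fin 3 → ℤ) (a : EuclideanSpace ℝ (Fin 3)) (j : Fin 3)
    (x : UnitAddTorus (Fin 3)) :
    partialDeriv j (⇑(stokesMode k a false)) x =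
      (2 * Real.pi * (k j : ℝ) * (UnitAddTorus.mFourier k x).re) • a := by
  -- the sine mode is `L ∘ e_k` for the real-linear `L z = (Im z) • a`, and `∂ⱼ e_k = 2πi kⱼ e_k`
  have e : (⇑(stokesMode k a false) : UnitAddTorus (Fin 3) → EuclideanSpace ℝ (Fin 3)) =
      ⇑(Complex.imCLM.smulRight a) ∘ ⇑(UnitAddTorus.mFourier k) := by
    funext y
    simp [stokesMode_apply]
  rw [e, partialDeriv_clm_comp (isSmooth_mFourier k) _ j x, partialDeriv_mFourier,
    ContinuousLinearMap.smulRight_apply, Complex.imCLM_apply]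
  congr 1
  simp

/-- The two-mode sine pattern `A (Im e_{k₁} a₁ + Im e_{k₂} a₂)` is `C¹`. [folklore] -/
theorem isContDiff_one_design (A : ℝ) (k₁ k₂ : Fin 3 → ℤ) (a₁ a₂ : EuclideanSpace ℝ (Fin 3)) :
    IsContDiff 1 (fun y => A • (stokesMode k₁ a₁ false y + stokesMode k₂ a₂ false y)) :=
  (((isSmooth_stokesMode k₁ a₁ false).add (isSmooth_stokesMode k₂ a₂ false)).smul A).isContDiff
    (by simp)

/-- `∂ⱼ (A (Im e_{k₁} a₁ + Im e_{k₂} a₂)) = A ((2π (k₁)ⱼ Re e_{k₁}) a₁ + (2π (k₂)ⱼ Re e_{k₂}) a₂)`. [folklore] -/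
theorem partialDeriv_design (A : ℝ) (k₁ k₂ : Fin 3 → ℤ) (a₁ a₂ : EuclideanSpace ℝ (Fin 3))
    (j : Fin 3) (x : UnitAddTorus (Fin 3)) :
    partialDeriv j (fun y => A • (stokesMode k₁ a₁ false y + stokesMode k₂ a₂ false y)) x =
      A • ((2 * Real.pi * (k₁ j : ℝ) * (UnitAddTorus.mFourier k₁ x).re) • a₁ +
        (2 * Real.pi * (k₂ j : ℝ) * (UnitAddTorus.mFourier k₂ x).re) • a₂) := by
  have h₁ : IsContDiff 1 (⇑(stokesMode k₁ a₁ false) : UnitAddTorus (Fin 3) → EuclideanSpace ℝ (Fin 3)) :=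
    (isSmooth_stokesMode k₁ a₁ false).isContDiff (by simp)
  have h₂ : IsContDiff 1 (⇑(stokesMode k₂ a₂ false) : UnitAddTorus (Fin 3) → EuclideanSpace ℝ (Fin 3)) :=
    (isSmooth_stokesMode k₂ a₂ false).isContDiff (by simp)
  have e : (fun y => A • (stokesMode k₁ a₁ false y + stokesMode k₂ a₂ false y)) =
      A • (⇑(stokesMode k₁ a₁ false) + ⇑(stokesMode k₂ a₂ false)) := rfl
  rw [e, partialDeriv_const_smul (h₁.add h₂) A j, Pi.smul_apply, partialDeriv_add h₁ h₂, Pi.add_apply,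
    partialDeriv_stokesMode_sin, partialDeriv_stokesMode_sin]

/-! ### The quadratic form of the velocity gradient -/

/-- `⟪ξ, (ξ·∇)G⟫ = 2πA Σᵢ ((ξ·kᵢ) Re e_{kᵢ} ⟪ξ, aᵢ⟫)` for the two-mode sine pattern
`G = A (Im e_{k₁} a₁ + Im e_{k₂} a₂)`: `(ξ·∇)G = DG[ξ] = Σⱼ ξⱼ ∂ⱼG`. [folklore] -/
theorem inner_convect_const_design (A : ℝ) (k₁ k₂ : Fin 3 → ℤ) (a₁ a₂ : EuclideanSpace ℝ (Fin 3))
    (x : UnitAddTorus (Fin 3)) (ξ : EuclideanSpace ℝ (Fin 3)) :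
    ⟪ξ, convect (fun _ => ξ) (fun y => A • (stokesMode k₁ a₁ false y + stokesMode k₂ a₂ false y)) x⟫ =
      2 * Real.pi * A *
        ((ξ 0 * (k₁ 0 : ℝ) + ξ 1 * (k₁ 1 : ℝ) + ξ 2 * (k₁ 2 : ℝ)) * (UnitAddTorus.mFourier k₁ x).re *
            ⟪ξ, a₁⟫ +
          (ξ 0 * (k₂ 0 : ℝ) + ξ 1 * (k₂ 1 : ℝ) + ξ 2 * (k₂ 2 : ℝ)) * (UnitAddTorus.mFourier k₂ x).re *
            ⟪ξ, a₂⟫) := by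
  rw [Torus.convect, fderiv_apply_eq_sum_partialDeriv (isContDiff_one_design A k₁ k₂ a₁ a₂)]
  simp only [Fin.sum_univ_three, partialDeriv_design, inner_add_right, inner_smul_right]
  ring

end AcdcStrain

/-- **Stub (W9) of crux `GridThesis`, line `Sketch`: the strain constant of the AC/DC grid.**
For the cellular two-mode Stokes pattern `G = A[sin 2πm(x₁+x₂)·(e₁−e₂) + sin 2πm(x₁−x₂)·(e₁+e₂)]`
and every `ξ ∈ ℝ³`: `|⟪ξ, (ξ·∇)G(x)⟫| ≤ 4πmA |ξ|²`. Indeed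
`⟪ξ, (ξ·∇)G⟫ = 2πmA (cos 2πm(x₁+x₂) + cos 2πm(x₁−x₂)) (ξ₁² − ξ₂²)` (`AcdcStrain.inner_convect_const_design`,
the cross terms cancel) and `|cos| ≤ 1`, `|ξ₁² − ξ₂²| ≤ |ξ|²`. Tree: `Torus.convect`,
`Torus.fderiv_apply_eq_sum_partialDeriv`, `Torus.stokesMode`, `Torus.partialDeriv_mFourier`,
`UnitAddTorus.mFourier_norm` (Constantin–Foias 1988, Ch. 4, (4.13)–(4.14); Grafakos 2014,
Prop. 3.2.6). [folklore] -/
theorem stub_acdcStrainBound :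
    ∀ (m : ℕ) (A : ℝ) (G : UnitAddTorus (Fin 3) → EuclideanSpace ℝ (Fin 3)),
      G = (fun x => A • (stokesMode ![(0 : ℤ), (m : ℤ), (m : ℤ)] (EuclideanSpace.single (1 : Fin 3) (1 : ℝ) - EuclideanSpace.single (2 : Fin 3) (1 : ℝ)) false x +
          stokesMode ![(0 : ℤ), (m : ℤ), -(m : ℤ)] (EuclideanSpace.single (1 : Fin 3) (1 : ℝ) + EuclideanSpace.single (2 : Fin 3) (1 : ℝ)) false x)) →
      0 < A →
      ∀ (x : UnitAddTorus (Fin 3)) (ξ : EuclideanSpace ℝ (Fin 3)), |⟪ξ, convect (fun _ => ξ) G x⟫| ≤ (4 * Real.pi * (m : ℝ) * A) * ‖ξ‖ ^ 2 := by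
  intro m A G hG hA x ξ
  -- the two phases `p = cos 2πm(x₁+x₂)`, `q = cos 2πm(x₁-x₂)`, both in `[-1, 1]`
  obtain ⟨p, hp⟩ : ∃ p, (UnitAddTorus.mFourier ![(0 : ℤ), (m : ℤ), (m : ℤ)] x).re = p := ⟨_, rfl⟩
  obtain ⟨q, hq⟩ : ∃ q, (UnitAddTorus.mFourier ![(0 : ℤ), (m : ℤ), -(m : ℤ)] x).re = q := ⟨_, rfl⟩
  have hp1 : |p| ≤ 1 := by
    rw [← hp]
    exact (Complex.abs_re_le_norm _).trans
      (((UnitAddTorus.mFourier _).norm_coe_le_norm x).trans_eq UnitAddTorus.mFourier_norm)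
  have hq1 : |q| ≤ 1 := by
    rw [← hq]
    exact (Complex.abs_re_le_norm _).trans
      (((UnitAddTorus.mFourier _).norm_coe_le_norm x).trans_eq UnitAddTorus.mFourier_norm)
  -- the quadratic form in closed form
  have key : ⟪ξ, convect (fun _ => ξ) G x⟫ =
      2 * Real.pi * (m : ℝ) * A * (p + q) * (ξ 1 ^ 2 - ξ 2 ^ 2) := by
    rw [hG, AcdcStrain.inner_convect_const_design, hp, hq]
    simp only [inner_sub_right, inner_add_right, EuclideanSpace.inner_single_right, conj_trivial,
      Matrix.cons_val_zero, Matrix.cons_val_one, Matrix.cons_val_two, Matrix.head_cons,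
      Matrix.tail_cons, Int.cast_zero, Int.cast_neg, Int.cast_natCast]
    ring
  -- the bound
  have hξ : |ξ 1 ^ 2 - ξ 2 ^ 2| ≤ ‖ξ‖ ^ 2 := by
    rw [EuclideanSpace.real_norm_sq_eq, Fin.sum_univ_three, abs_le]
    constructor <;> nlinarith [sq_nonneg (ξ 0), sq_nonneg (ξ 1), sq_nonneg (ξ 2)]
  have hpq : |p + q| ≤ 2 := by
    rw [abs_le] at hp1 hq1 ⊢
    constructor <;> linarith [hp1.1, hp1.2, hq1.1, hq1.2]
  have hc : 0 ≤ 2 * Real.pi * (m : ℝ) * A := by positivity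
  rw [key, abs_mul, abs_mul, abs_of_nonneg hc]
  calc 2 * Real.pi * (m : ℝ) * A * |p + q| * |ξ 1 ^ 2 - ξ 2 ^ 2|
      ≤ 2 * Real.pi * (m : ℝ) * A * 2 * ‖ξ‖ ^ 2 :=
        mul_le_mul (mul_le_mul_of_nonneg_left hpq hc) hξ (abs_nonneg _) (by positivity)
    _ = (4 * Real.pi * (m : ℝ) * A) * ‖ξ‖ ^ 2 := by ring

end Summit.AnomalousDissipation.AnomalousDissipation.Theorems

end
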